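import Mathlib.GroupTheory.Index
import Mathlib.Topology.Algebra.Group.ClosedSubgroup
import Mathlib.Topology.Algebra.OpenSubgroup
import Literature.NumberTheory.GaloisRepresentations.ArtinFormalism
import Literature.NumberTheory.GaloisRepresentations.ArtinLFunctionProofs
import Literature.NumberTheory.GaloisRepresentations.ArtinFormalismInductionProofs
import Literature.RepresentationTheory.FiniteGroups.InducedRecognition
import Literature.RepresentationTheory.FiniteGroups.InducedDimension
import HarnessLib

/-!
# Induced Artin representations exist: proof of `exists_framedArtinRep_isInducedFrom`
(Serre, *Linear Representations of Finite Groups*, §3.3 Thm. 11; companion to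
`Literature.NumberTheory.GaloisRepresentations.ArtinFormalism`)

D-0014 keeps `Literature/` sorry-free by stating cited results as named facts.  This file
**proves** the named fact
`Literature.NumberTheory.GaloisRepresentations.exists_framedArtinRep_isInducedFrom` of
`ArtinFormalism` as `exists_framedArtinRep_isInducedFrom_holds`: for a finite extension `M/K`
of number fields and an Artin representation `π` of `Γ_M` on `W` (module topology) there is a
framed Artin representation `ρ : Γ_K →ₜ* GL_n(ℂ)`, `n = [M:K] · dim W`, with
`ρ ≅ Ind_{Γ_M}^{Γ_K} π` (`ArtinRep.IsInducedFrom`, Mathlib `Representation.ind` along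
`absGaloisRestrict K M : Γ_M → Γ_K`).

Serre, *Linear Representations of Finite Groups*, §3.3: a representation `V` of `G` induced
by the representation `W` of the subgroup `H` has `dim V = (G:H) · dim W` ((ii) after the
Definition), exists and is unique up to isomorphism (Thm. 11; §7.1, Prop. 18 and Remark (1):
`Ind_H^G W = ℂ[G] ⊗_{ℂ[H]} W`, and Exercise 7.1 for induction `Ind_α` along a homomorphism
`α : H → G`, which is Mathlib's `Representation.ind`); §4.3, Remark (g): for a *compact* group
`G` and a closed subgroup `H` of finite index the notion of induced representation and Thm. 11
remain valid.  The proof here follows this architecture for `G = Γ_K`, `H = Γ_M`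
(embedded by `φ = absGaloisRestrict K M`, injective with image of index `[M:K]`,
`index_range_absGaloisRestrict_eq_finrank`):

1. **Dimension** (Serre §3.3 (ii)): `dim Ind π = [Γ_K : φΓ_M] · dim W = [M:K] · dim W`
   (`Literature.RepresentationTheory.FiniteGroups.finrank_indV_eq`, `InducedDimension`).
2. **Continuity** (the content of Serre §4.3 (g) for the profinite group `Γ_K`): the kernel
   `U = ker π` is open in `Γ_M` (`ArtinRep.isOpen_ker`), so `φ(U)` is closed (compact image)
   of finite index in `Γ_K`; its normal core `N` is closed of finite index, hence open
   (Mathlib `Subgroup.normalCore_isClosed`, `Subgroup.isOpen_of_isClosed_of_finiteIndex`),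
   and acts trivially on `Ind π = (ℂ[Γ_K] ⊗ W)_{Γ_M}`
   (`Representation.ind_apply_eq_one_of_mem_normalCore`:
   `n • ⟦h ⊗ a⟧ = ⟦h n⁻¹ ⊗ a⟧ = ⟦φ(g) h ⊗ π(g) a⟧ = ⟦h ⊗ a⟧` for `h n⁻¹ h⁻¹ = φ(g)`,
   `g ∈ ker π`).  A representation trivial on an open subgroup is jointly continuous for the
   module topology (`Representation.continuous_smul_of_isOpen_of_le_ker`).
3. **Framing**: choose a basis of `Ind π` indexed by `Fin ([M:K] · dim W)` and take the frame
   `ContinuousRep.frame` with its equivalence `ContinuousRep.frameEquiv` (`ContinuousRep`).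

## Mathlib search

Mathlib (this pin) has `Representation.ind`, `Representation.IndV`, `Representation.ind_mk`,
`Subgroup.normalCore`, `Subgroup.finiteIndex_normalCore`, `Subgroup.normalCore_isClosed`,
`Subgroup.isOpen_of_isClosed_of_finiteIndex`, `Subgroup.quotient_finite_of_isOpen`,
`Subgroup.index_map`, `IsModuleTopology.continuous_of_linearMap`, `moduleTopology`, and the
related `IsTopologicalGroup.exist_openNormalSubgroup_sub_clopen_nhds_of_one` (an open normal
subgroup inside a clopen neighbourhood of `1` of a compact group); it has no topology or
continuity statement for `Representation.ind` / `Representation.IndV` and no Artin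
representations (`lean search 'IndV.*TopologicalSpace'`, `'Continuous.*Representation.ind'`:
nothing).  The tree has `ContinuousRep.frame`, `ContinuousRep.frameEquiv`,
`ArtinRep.isOpen_ker`, `finrank_indV_eq`, `index_range_absGaloisRestrict_eq_finrank`;
nothing here duplicates an existing declaration.

## References

* J.-P. Serre, *Linear Representations of Finite Groups*, GTM 42, Springer (1977), §3.3
  (Definition, (ii): `dim V = (G:H) dim W`; Thm. 11), §4.3 Remark (g), §7.1 (Prop. 18,
  Remark (1), Exercise 7.1) (`SerreLinearRepresentations1977`).
* J. Neukirch, *Algebraic Number Theory*, Grundlehren 322 (1999), VII (10.2) a)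
  (`NeukirchANT1999`).
-/

noncomputable section

open Module Topology

namespace Literature.NumberTheory.GaloisRepresentations

universe u u' w'

/-! ### Induced representations are trivial on the normal core of `φ(ker π)` -/

section Kernel

variable {k : Type*} [CommRing k] {G H : Type*} [Group G] [Group H]
  {A : Type*} [AddCommGroup A] [Module k A]

/-- **`Ind π` is trivial on the normal core of `φ(ker π)`.**  For `φ : H →* G`, a
representation `π` of `H` on `A` and `n` in the normal core of the subgroup `φ(ker π)` of
`G`, the induced representation `Ind π = (k[G] ⊗ A)_H` (Mathlib `Representation.ind`,
`g • ⟦g₁ ⊗ a⟧ = ⟦g₁ g⁻¹ ⊗ a⟧`) satisfies `(Ind π)(n) = 1`: on a generator,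
`n • ⟦h ⊗ a⟧ = ⟦h n⁻¹ ⊗ a⟧ = ⟦φ(g) h ⊗ π(g) a⟧ = ⟦h ⊗ a⟧` where `h n⁻¹ h⁻¹ = φ(g)` with
`g ∈ ker π`.  (For `H ≤ G` finite this is the statement that `Ind_H^G W` factors through
`G / ⋂ s (ker θ) s⁻¹`; an immediate consequence of the definition
`Ind W = ℂ[G] ⊗_{ℂ[H]} W`.)
Ref: Serre, *Linear Representations of Finite Groups*, §7.1 (`Ind W = ℂ[G] ⊗_{ℂ[H]} W`,
Prop. 18) and Exercise 7.1 (induction along a homomorphism). [folklore] -/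
theorem Representation.ind_apply_eq_one_of_mem_normalCore (φ : H →* G)
    (π : Representation k H A) {n : G}
    (hn : n ∈ (((MonoidHom.ker π).map φ).normalCore : Subgroup G)) :
    Representation.ind φ π n = 1 := by
  refine Representation.IndV.hom_ext φ π fun h => LinearMap.ext fun a => ?_
  change Representation.ind φ π n (Representation.IndV.mk φ π h a) =
    Representation.IndV.mk φ π h a
  rw [Representation.ind_mk]
  have hmem : h * n⁻¹ * h⁻¹ ∈ (MonoidHom.ker π).map φ :=
    Subgroup.normalCore_le _ ((Subgroup.normalCore_normal _).conj_mem _ (Subgroup.inv_mem _ hn) h)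
  obtain ⟨g, hg, hgeq⟩ := Subgroup.mem_map.mp hmem
  have h1 : h * n⁻¹ = φ g * h := by rw [hgeq, inv_mul_cancel_right]
  have hπg : π g a = a := by rw [MonoidHom.mem_ker.mp hg, Module.End.one_apply]
  calc Representation.IndV.mk φ π (h * n⁻¹) a
      = Representation.IndV.mk φ π (φ g * h) (π g a) := by rw [h1, hπg]
    _ = Representation.IndV.mk φ π h a :=
        Literature.RepresentationTheory.FiniteGroups.indV_mk_mul_apply φ π g h a

end Kernel

/-! ### Topology: open normal cores and continuity of locally constant actions -/

section Topology

variable {G H : Type*} [Group G] [TopologicalSpace G] [IsTopologicalGroup G]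
  [Group H] [TopologicalSpace H] [IsTopologicalGroup H]

/-- **The normal core of the image of an open subgroup of a compact group is open.**  Let
`φ : H →ₜ* G` be a continuous homomorphism from a compact group `H` to a Hausdorff
topological group `G` with image of finite index, and `U ≤ H` an open subgroup.  Then the
normal core of `φ(U)` in `G` is open: `U` is closed, hence compact, so `φ(U)` is closed; it
has finite index `[G : φ(U)] = [H : U · ker φ] [G : φ(H)]` (Mathlib `Subgroup.index_map`,
`Subgroup.quotient_finite_of_isOpen`); so its normal core is closed of finite index
(`Subgroup.normalCore_isClosed`, `Subgroup.finiteIndex_normalCore`), hence open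
(`Subgroup.isOpen_of_isClosed_of_finiteIndex`).  (Serre §4.3 (g): induced representations
from closed subgroups of finite index of compact groups.) [folklore] -/
theorem isOpen_normalCore_map_of_isOpen [CompactSpace H] [T2Space G] (φ : H →ₜ* G)
    [φ.toMonoidHom.range.FiniteIndex] (U : Subgroup H) (hU : IsOpen (U : Set H)) :
    IsOpen (((U.map φ.toMonoidHom).normalCore : Subgroup G) : Set G) := by
  haveI : Finite (H ⧸ U) := Subgroup.quotient_finite_of_isOpen U hU
  haveI : U.FiniteIndex := Subgroup.finiteIndex_of_finite_quotient
  haveI : (U ⊔ φ.toMonoidHom.ker).FiniteIndex := Subgroup.finiteIndex_of_le le_sup_left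
  haveI : (U.map φ.toMonoidHom).FiniteIndex := ⟨by
    rw [Subgroup.index_map]
    exact mul_ne_zero Subgroup.FiniteIndex.index_ne_zero Subgroup.FiniteIndex.index_ne_zero⟩
  have hclosed : IsClosed ((U.map φ.toMonoidHom : Subgroup G) : Set G) := by
    rw [Subgroup.coe_map]
    exact ((Subgroup.isClosed_of_isOpen U hU).isCompact.image φ.continuous).isClosed
  exact Subgroup.isOpen_of_isClosed_of_finiteIndex _ (Subgroup.normalCore_isClosed _ hclosed)

variable {k : Type*} [CommRing k] [TopologicalSpace k]
  {V : Type*} [AddCommGroup V] [Module k V] [TopologicalSpace V] [IsModuleTopology k V]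

omit [IsTopologicalGroup G] in
/-- **A representation trivial on an open subgroup is jointly continuous** for the module
topology: if `N ≤ ker σ` with `N` open in `G`, then `(g, v) ↦ σ g v` is continuous on
`G × V` — near `(g₀, v₀)` (for `g ∈ g₀ N`) it is the continuous linear map `v ↦ σ g₀ v`
(`IsModuleTopology.continuous_of_linearMap`).
Ref: Serre, *Linear Representations of Finite Groups*, §4.3 (g); Serre, *Abelian ℓ-adic
representations* (1968), Ch. I §1.1. [folklore] -/
theorem Representation.continuous_smul_of_isOpen_of_le_ker [ContinuousMul G]
    (σ : Representation k G V) (N : Subgroup G) (hN : IsOpen (N : Set G))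
    (hle : N ≤ MonoidHom.ker σ) : Continuous fun p : G × V => σ p.1 p.2 := by
  haveI : ContinuousAdd V := IsModuleTopology.toContinuousAdd k V
  refine continuous_iff_continuousAt.2 fun p => ?_
  have hc : Continuous fun q : G × V => σ p.1 q.2 :=
    (IsModuleTopology.continuous_of_linearMap (σ p.1)).comp continuous_snd
  refine hc.continuousAt.congr ?_
  have hmem : {q : G × V | p.1⁻¹ * q.1 ∈ N} ∈ 𝓝 p := by
    refine IsOpen.mem_nhds (hN.preimage (continuous_const.mul continuous_fst)) ?_
    show p.1⁻¹ * p.1 ∈ N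
    rw [inv_mul_cancel]
    exact N.one_mem
  filter_upwards [hmem] with q hq
  have hσ : σ q.1 = σ p.1 := by
    have h1 : q.1 = p.1 * (p.1⁻¹ * q.1) := by rw [mul_inv_cancel_left]
    rw [h1, map_mul, MonoidHom.mem_ker.mp (hle hq), mul_one]
  simp only [hσ]

end Topology

/-! ### The discharge -/

section Artin

open Field

variable {K : Type u} [Field K] [NumberField K] {M : Type u'} [Field M] [NumberField M]
  [Algebra K M] {W : Type w'} [AddCommGroup W] [Module ℂ W] [TopologicalSpace W]
  [FiniteDimensional ℂ W]

/-- **Discharge of `exists_framedArtinRep_isInducedFrom` (Serre, *Linear Representations of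
Finite Groups*, §3.3 Thm. 11 with (ii) `dim V = (G:H) dim W`, §4.3 (g), §7.1).**  For a
finite extension `M/K` of number fields and an Artin representation `π` of `Γ_M` on `W`
(module topology), the induced representation `Ind π` of `Γ_K` along
`φ = absGaloisRestrict K M` (Mathlib `Representation.ind`) has dimension
`[Γ_K : φΓ_M] · dim W = [M:K] · dim W` (`finrank_indV_eq`,
`index_range_absGaloisRestrict_eq_finrank`), is trivial on the open normal core of
`φ(ker π)` (`ArtinRep.isOpen_ker`, `isOpen_normalCore_map_of_isOpen`,
`Representation.ind_apply_eq_one_of_mem_normalCore`), hence continuous for the module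
topology (`Representation.continuous_smul_of_isOpen_of_le_ker`); framing it by a basis
indexed by `Fin ([M:K] · dim W)` (`ContinuousRep.frame`, `ContinuousRep.frameEquiv`) gives
the framed Artin representation `ρ` with `ρ ≅ Ind π` (`ArtinRep.IsInducedFrom`).
[cite: SerreLinearRepresentations1977, §3.3 Thm. 11 and §7.1] -/
theorem exists_framedArtinRep_isInducedFrom_holds :
    exists_framedArtinRep_isInducedFrom (K := K) (M := M) (W := W) := by
  intro _ π
  classical
  -- the restriction map `φ : Γ_M → Γ_K`
  set φ : absoluteGaloisGroup M →* absoluteGaloisGroup K := (absGaloisRestrict K M).toMonoidHom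
    with hφ
  have hφinj : Function.Injective φ := absGaloisRestrict_injective K M
  haveI : FiniteDimensional K M := Module.Finite.right ℚ K M
  haveI hφfi : φ.range.FiniteIndex := finiteIndex_range_absGaloisRestrict K M
  -- the induced representation and its dimension (Serre §3.3 (ii))
  haveI hfinI : FiniteDimensional ℂ (Representation.IndV φ π.toRepresentation) :=
    (Literature.RepresentationTheory.FiniteGroups.finrank_indV_le (k := ℂ) φ
      π.toRepresentation).1
  have hdim : Module.finrank ℂ (Representation.IndV φ π.toRepresentation) =
      Module.finrank K M * Module.finrank ℂ W := by
    rw [Literature.RepresentationTheory.FiniteGroups.finrank_indV_eq φ π.toRepresentation hφinj]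
    congr 1
    exact index_range_absGaloisRestrict_eq_finrank K M
  -- the module topology on `Ind π`
  letI : TopologicalSpace (Representation.IndV φ π.toRepresentation) :=
    moduleTopology ℂ (Representation.IndV φ π.toRepresentation)
  haveI : IsModuleTopology ℂ (Representation.IndV φ π.toRepresentation) := ⟨rfl⟩
  -- the open normal core of `φ(ker π)` acts trivially (Serre §4.3 (g))
  have hNopen : IsOpen ((((MonoidHom.ker π.toRepresentation).map φ).normalCore :
      Subgroup (absoluteGaloisGroup K)) : Set (absoluteGaloisGroup K)) :=
    isOpen_normalCore_map_of_isOpen (absGaloisRestrict K M) _ π.isOpen_ker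
  have hNle : ((MonoidHom.ker π.toRepresentation).map φ).normalCore ≤
      MonoidHom.ker (Representation.ind φ π.toRepresentation) := fun n hn =>
    MonoidHom.mem_ker.mpr (Representation.ind_apply_eq_one_of_mem_normalCore φ _ hn)
  -- the continuous representation `Ind π` of `Γ_K`
  let indC : ArtinRep K (Representation.IndV φ π.toRepresentation) :=
    { toRepresentation := Representation.ind φ π.toRepresentation
      continuous_smul :=
        Representation.continuous_smul_of_isOpen_of_le_ker _ _ hNopen hNle }
  -- a frame indexed by `Fin ([M:K] · dim W)`
  let b : Module.Basis (Fin (Module.finrank K M * Module.finrank ℂ W)) ℂ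
      (Representation.IndV φ π.toRepresentation) :=
    (Module.finBasis ℂ _).reindex (finCongr hdim)
  exact ⟨indC.frame b, ⟨(indC.frameEquiv b).toRepEquiv⟩⟩

end Artin

end Literature.NumberTheory.GaloisRepresentations
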